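import Mathlib
import Summits.Ventures.PercRepro2.Defs
import Summits.Ventures.PercRepro2.Harris
import Summits.Ventures.PercRepro2.Graph
import Summits.Ventures.PercRepro2.Exploration
import Summits.Ventures.PercRepro2.Events
import Summits.Ventures.PercRepro2.CutVertexDefs
import Summits.Ventures.PercRepro2.CDCutVertex

/-!
# (T_h) when the hit vertex is a cut vertex separating the root from the up-sets: a THEOREM
(blind cell PercRepro2, mine-a g46; MINE-A.md §101.5 (c))

Let `x` be a cut vertex (`CutV.IsCut ends x VA VB EA EB`), the root `s ∈ VA`, the hit vertex `x`
itself, and the up-sets `𝓤`, `𝓥` read on `VB` (`S ∈ 𝓤 ↔ S ∩ VB ∈ 𝓤`, `∅ ∉ 𝓤`).  Then `Q = {x ∈ C_s}`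
is the `A`-side event `{s ↔ x}`, and `U = Q ∩ {C_x ∈ 𝓤 inside B}` (`clusterInEvent_far_eq`, the far-side lemma of `TCutVertex` re-proved here so that this file does not wait for its olean),
so with `ξ = P(s ↔ x)`, `u = P_{p_B}(C_x ∈ 𝓤)`, `ε = P_{p_B}(C_x ∈ 𝓥)`, `m = P_{p_B}(C_x ∈ 𝓤 ∩ 𝓥)`:

  `T(p, s, x) = ξ (1 + ξ) m − 2 ξ² u ε`   (`t_hit_cut_identity`),

and Harris on the far side (`m ≥ u ε`) gives `T ≥ ξ (1 − ξ) u ε ≥ 0`: **(T_h) holds unconditionally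
whenever the hit vertex separates the root from the generators** (`t_of_hit_cut`) — the block of
the generators hangs at `h`, and the hit-conditioned law of `C_s` is the product of a point mass
and the far-side cluster law, which is positively associated.  Likewise with the ROOT at the cut
vertex and the hit vertex beyond it, `Q` is a far-side event independent of the near-side `U`, `e`,
and `T = 2 q · Cov(U, e) ≥ 0` (`t_of_root_cut`).  No definition; one seat.
-/

namespace Summit.Ventures.PercRepro2

namespace TCutVertexHit

open CutV

variable {V : Type*} {E : Type*} [Fintype E] [DecidableEq E]
  {R : Type*} [Field R] [LinearOrder R] [IsStrictOrderedRing R]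
variable {ends : E → Sym2 V} {x : V} {VA VB : Set V} {EA EB : Set E}
  [DecidablePred (· ∈ EA)] [DecidablePred (· ∈ EB)]

/-! ## Far-side events across the cut (the three lemmas of `TCutVertex`, restated locally) -/
section Far

omit [Fintype E] [DecidableEq E] [Field R] [LinearOrder R] [IsStrictOrderedRing R]
  [DecidablePred (· ∈ EA)] [DecidablePred (· ∈ EB)] in
/-- A side event of an intersection is the intersection of the side events. -/
lemma sideEvent_inter' (F : Set E) [DecidablePred (· ∈ F)] (X Y : Set (Config E)) :
    sideEvent F (X ∩ Y) = sideEvent F X ∩ sideEvent F Y := by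
  ext ω
  simp only [mem_sideEvent, Set.mem_inter_iff]

omit [Fintype E] [DecidableEq E] [Field R] [LinearOrder R] [IsStrictOrderedRing R]
  [DecidablePred (· ∈ EB)] in
/-- The `A`-side cluster of an `A`-vertex misses `VB`. -/
lemma cluster_restrict_inter_eq_empty' (h : IsCut ends x VA VB EA EB) {ω : Config E} {s : V}
    (hs : s ∈ VA) : cluster ends (restrict EA ω) s ∩ VB = ∅ := by
  apply Set.eq_empty_of_forall_notMem
  intro v hv
  have hv1 : v ∈ VA ∪ {x} := cluster_restrict_subset h (Or.inl hs) hv.1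
  rcases hv1 with hvA | hvx
  · exact h.disj.notMem_of_mem_left hvA hv.2
  · rw [Set.mem_singleton_iff] at hvx
    rw [hvx] at hv
    exact h.x_notB hv.2

omit [Fintype E] [DecidableEq E] [Field R] [LinearOrder R] [IsStrictOrderedRing R] in
/-- A cluster event read on `VB` (`S ∈ 𝓤 ↔ S ∩ VB ∈ 𝓤`, `∅ ∉ 𝓤`) is
`{s ↔ x inside A} ∩ {C_x ∈ 𝓤 inside B}`. -/
theorem clusterInEvent_far_eq (h : IsCut ends x VA VB EA EB) {s : V} (hs : s ∈ VA)
    {𝓤 : Set (Set V)} (h𝓤 : ∀ S, S ∈ 𝓤 ↔ S ∩ VB ∈ 𝓤) (h𝓤0 : ∅ ∉ 𝓤) :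
    clusterInEvent ends s 𝓤 =
      sideEvent EA (connEvent ends s x) ∩ sideEvent EB (clusterInEvent ends x 𝓤) := by
  ext ω
  simp only [mem_clusterInEvent, Set.mem_inter_iff, mem_sideEvent]
  change cluster ends ω s ∈ 𝓤 ↔ Conn ends (restrict EA ω) s x ∧ cluster ends (restrict EB ω) x ∈ 𝓤
  by_cases hx : Conn ends (restrict EA ω) s x
  · have key : cluster ends ω s ∈ 𝓤 ↔ cluster ends (restrict EB ω) x ∈ 𝓤 := by
      rw [h𝓤 (cluster ends ω s), h𝓤 (cluster ends (restrict EB ω) x), cluster_eq_union h hs hx,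
        Set.union_inter_distrib_right, cluster_restrict_inter_eq_empty' h hs, Set.empty_union]
    exact ⟨fun hU => ⟨hx, key.1 hU⟩, fun hU => key.2 hU.2⟩
  · have hno : cluster ends ω s ∉ 𝓤 := by
      rw [h𝓤 (cluster ends ω s), cluster_eq_of_not_conn h hs hx,
        cluster_restrict_inter_eq_empty' h hs]
      exact h𝓤0
    exact ⟨fun hU => absurd hU hno, fun hU => absurd hU.1 hx⟩

omit [LinearOrder R] [IsStrictOrderedRing R] in
/-- `P({s ↔ x inside A} ∩ {B-side event}) = ξ · P_{p_B}(B-side event)`. -/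
lemma prob_near_inter_side' (p : E → R) (h : IsCut ends x VA VB EA EB) {s : V} (hs : s ∈ VA)
    (X : Set (Config E)) :
    prob p (sideEvent EA (connEvent ends s x) ∩ sideEvent EB X) =
      prob p (connEvent ends s x) * prob (fun e => if e ∈ EB then p e else 0) X := by
  rw [prob_sideEvent_inter_eq_mul p h, CDCutVertex.prob_zeroOff_eq_prob_sideEvent p EB X,
    ← connEvent_eq_sideEvent h (Or.inl hs) (Or.inr rfl)]

end Far

omit [Fintype E] [DecidableEq E] [Field R] [LinearOrder R] [IsStrictOrderedRing R]
  [DecidablePred (· ∈ EB)] in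
/-- The hit event of the cut vertex is the `A`-side connection event. -/
lemma hit_cut_eq (h : IsCut ends x VA VB EA EB) {s : V} (hs : s ∈ VA) :
    clusterInEvent ends s {T : Set V | x ∈ T} = sideEvent EA (connEvent ends s x) := by
  rw [← connEvent_eq_sideEvent h (Or.inl hs) (Or.inr rfl)]
  ext ω
  simp only [mem_clusterInEvent, Set.mem_setOf_eq, mem_cluster]
  exact Iff.rfl

omit [LinearOrder R] [IsStrictOrderedRing R] in
/-- **The (T)-form with the hit vertex at the cut**: `T(p, s, x) = ξ (1 + ξ) m − 2 ξ² u ε`. -/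
theorem t_hit_cut_identity (p : E → R) (h : IsCut ends x VA VB EA EB) {s : V} (hs : s ∈ VA)
    {𝓤 𝓥 : Set (Set V)} (h𝓤 : ∀ S, S ∈ 𝓤 ↔ S ∩ VB ∈ 𝓤) (h𝓤0 : ∅ ∉ 𝓤)
    (h𝓥 : ∀ S, S ∈ 𝓥 ↔ S ∩ VB ∈ 𝓥) (h𝓥0 : ∅ ∉ 𝓥) :
    prob p (clusterInEvent ends s {T : Set V | x ∈ T} ∩ clusterInEvent ends s 𝓤 ∩
        clusterInEvent ends s 𝓥) +
      prob p (clusterInEvent ends s {T : Set V | x ∈ T}) *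
        prob p (clusterInEvent ends s 𝓤 ∩ clusterInEvent ends s 𝓥) -
      prob p (clusterInEvent ends s {T : Set V | x ∈ T} ∩ clusterInEvent ends s 𝓤) *
        prob p (clusterInEvent ends s 𝓥) -
      prob p (clusterInEvent ends s {T : Set V | x ∈ T} ∩ clusterInEvent ends s 𝓥) *
        prob p (clusterInEvent ends s 𝓤) =
    prob p (connEvent ends s x) * (1 + prob p (connEvent ends s x)) *
        prob (fun e => if e ∈ EB then p e else 0)
          (clusterInEvent ends x 𝓤 ∩ clusterInEvent ends x 𝓥) -
      2 * prob p (connEvent ends s x) ^ 2 *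
        (prob (fun e => if e ∈ EB then p e else 0) (clusterInEvent ends x 𝓤) *
          prob (fun e => if e ∈ EB then p e else 0) (clusterInEvent ends x 𝓥)) := by
  have hQ := hit_cut_eq (EB := EB) h hs
  have hU := clusterInEvent_far_eq (EA := EA) h hs h𝓤 h𝓤0
  have hE := clusterInEvent_far_eq (EA := EA) h hs h𝓥 h𝓥0
  rw [hQ, hU, hE]
  set A := sideEvent EA (connEvent ends s x) with hA
  have r1 : A ∩ (A ∩ sideEvent EB (clusterInEvent ends x 𝓤)) ∩
      (A ∩ sideEvent EB (clusterInEvent ends x 𝓥)) =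
      A ∩ sideEvent EB (clusterInEvent ends x 𝓤 ∩ clusterInEvent ends x 𝓥) := by
    rw [sideEvent_inter']; ext ω; simp only [Set.mem_inter_iff]; tauto
  have r2 : A ∩ sideEvent EB (clusterInEvent ends x 𝓤) ∩ (A ∩ sideEvent EB (clusterInEvent ends x 𝓥)) =
      A ∩ sideEvent EB (clusterInEvent ends x 𝓤 ∩ clusterInEvent ends x 𝓥) := by
    rw [sideEvent_inter']; ext ω; simp only [Set.mem_inter_iff]; tauto
  have r3 : A ∩ (A ∩ sideEvent EB (clusterInEvent ends x 𝓤)) =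
      A ∩ sideEvent EB (clusterInEvent ends x 𝓤) := by
    ext ω; simp only [Set.mem_inter_iff]; tauto
  have r4 : A ∩ (A ∩ sideEvent EB (clusterInEvent ends x 𝓥)) =
      A ∩ sideEvent EB (clusterInEvent ends x 𝓥) := by
    ext ω; simp only [Set.mem_inter_iff]; tauto
  have hAξ : prob p A = prob p (connEvent ends s x) := by
    rw [hA, ← connEvent_eq_sideEvent h (Or.inl hs) (Or.inr rfl)]
  rw [r1, r2, r3, r4, hA]
  simp only [prob_near_inter_side' p h hs]
  rw [← hA, hAξ]
  ring

/-- **(T_h) is a theorem when the hit vertex is a cut vertex separating the root from the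
generators** (up-sets read on the far side): `T ≥ ξ (1 − ξ) u ε ≥ 0` by Harris on the far side. -/
theorem t_of_hit_cut (p : E → R) (hp : IsProbVec p) (h : IsCut ends x VA VB EA EB) {s : V}
    (hs : s ∈ VA) {𝓤 𝓥 : Set (Set V)} (h𝓤 : ∀ S, S ∈ 𝓤 ↔ S ∩ VB ∈ 𝓤) (h𝓤0 : ∅ ∉ 𝓤)
    (h𝓤up : IsUpperSet 𝓤) (h𝓥 : ∀ S, S ∈ 𝓥 ↔ S ∩ VB ∈ 𝓥) (h𝓥0 : ∅ ∉ 𝓥)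
    (h𝓥up : IsUpperSet 𝓥) :
    prob p (clusterInEvent ends s {T : Set V | x ∈ T} ∩ clusterInEvent ends s 𝓤) *
        prob p (clusterInEvent ends s 𝓥) +
      prob p (clusterInEvent ends s 𝓤) *
        prob p (clusterInEvent ends s {T : Set V | x ∈ T} ∩ clusterInEvent ends s 𝓥) ≤
      prob p (clusterInEvent ends s {T : Set V | x ∈ T} ∩ clusterInEvent ends s 𝓤 ∩
          clusterInEvent ends s 𝓥) +
        prob p (clusterInEvent ends s {T : Set V | x ∈ T}) *
          prob p (clusterInEvent ends s 𝓤 ∩ clusterInEvent ends s 𝓥) := by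
  have hid := t_hit_cut_identity p h hs h𝓤 h𝓤0 h𝓥 h𝓥0
  have hp' : IsProbVec (fun e => if e ∈ EB then p e else 0) := CDCutVertex.isProbVec_zeroOff hp EB
  have hξ0 : 0 ≤ prob p (connEvent ends s x) := prob_nonneg hp _
  have hξ1 : prob p (connEvent ends s x) ≤ 1 := prob_le_one hp _
  have hu0 : 0 ≤ prob (fun e => if e ∈ EB then p e else 0) (clusterInEvent ends x 𝓤) :=
    prob_nonneg hp' _
  have hε0 : 0 ≤ prob (fun e => if e ∈ EB then p e else 0) (clusterInEvent ends x 𝓥) :=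
    prob_nonneg hp' _
  have hH : prob (fun e => if e ∈ EB then p e else 0) (clusterInEvent ends x 𝓤) *
      prob (fun e => if e ∈ EB then p e else 0) (clusterInEvent ends x 𝓥) ≤
      prob (fun e => if e ∈ EB then p e else 0)
        (clusterInEvent ends x 𝓤 ∩ clusterInEvent ends x 𝓥) :=
    prob_mul_prob_le_prob_inter hp' (isUpperSet_clusterInEvent ends x h𝓤up)
      (isUpperSet_clusterInEvent ends x h𝓥up)
  have h1 : 0 ≤ prob p (connEvent ends s x) * (1 + prob p (connEvent ends s x)) *
      (prob (fun e => if e ∈ EB then p e else 0)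
          (clusterInEvent ends x 𝓤 ∩ clusterInEvent ends x 𝓥) -
        prob (fun e => if e ∈ EB then p e else 0) (clusterInEvent ends x 𝓤) *
          prob (fun e => if e ∈ EB then p e else 0) (clusterInEvent ends x 𝓥)) :=
    mul_nonneg (mul_nonneg hξ0 (by linarith)) (by linarith)
  have h2 : 0 ≤ prob p (connEvent ends s x) * (1 - prob p (connEvent ends s x)) *
      (prob (fun e => if e ∈ EB then p e else 0) (clusterInEvent ends x 𝓤) *
        prob (fun e => if e ∈ EB then p e else 0) (clusterInEvent ends x 𝓥)) :=
    mul_nonneg (mul_nonneg hξ0 (by linarith)) (mul_nonneg hu0 hε0)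
  nlinarith [hid, h1, h2]

/-! ## The root at the cut: the hit vertex on one side, the up-sets on the other -/
section RootCut

omit [Fintype E] [DecidableEq E] [Field R] [LinearOrder R] [IsStrictOrderedRing R]
  [DecidablePred (· ∈ EA)] in
/-- With the root AT the cut vertex, the hit event of `h ∈ VB` is a `B`-side event. -/
lemma hit_root_eq (h : IsCut ends x VA VB EA EB) {hv : V} (hvB : hv ∈ VB) :
    clusterInEvent ends x {T : Set V | hv ∈ T} =
      sideEvent EB (clusterInEvent ends x {T : Set V | hv ∈ T}) := by
  ext ω
  simp only [mem_clusterInEvent, Set.mem_setOf_eq, mem_cluster, mem_sideEvent]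
  exact conn_iff_restrict h.symm (Or.inr rfl) (Or.inl hvB)

omit [Fintype E] [DecidableEq E] [Field R] [LinearOrder R] [IsStrictOrderedRing R]
  [DecidablePred (· ∈ EB)] in
/-- With the root AT the cut vertex, a cluster event read on `VA ∪ {x}` is an `A`-side event. -/
lemma clusterInEvent_root_eq (h : IsCut ends x VA VB EA EB) {𝓤 : Set (Set V)}
    (h𝓤 : ∀ S, S ∈ 𝓤 ↔ S ∩ (VA ∪ {x}) ∈ 𝓤) :
    clusterInEvent ends x 𝓤 = sideEvent EA (clusterInEvent ends x 𝓤) := by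
  ext ω
  simp only [mem_clusterInEvent, mem_sideEvent]
  rw [h𝓤 (cluster ends ω x), cluster_inter_eq h (Or.inr rfl)]

/-- **(T_h) is a theorem when the root is a cut vertex separating the hit vertex from the
generators**: `Q` is a `B`-side event, `U`, `e` are `A`-side events, so `T = 2 q · Cov_A(U, e) ≥ 0`
by the product law and Harris. -/
theorem t_of_root_cut (p : E → R) (hp : IsProbVec p) (h : IsCut ends x VA VB EA EB) {hv : V}
    (hvB : hv ∈ VB) {𝓤 𝓥 : Set (Set V)} (h𝓤 : ∀ S, S ∈ 𝓤 ↔ S ∩ (VA ∪ {x}) ∈ 𝓤)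
    (h𝓤up : IsUpperSet 𝓤) (h𝓥 : ∀ S, S ∈ 𝓥 ↔ S ∩ (VA ∪ {x}) ∈ 𝓥) (h𝓥up : IsUpperSet 𝓥) :
    prob p (clusterInEvent ends x {T : Set V | hv ∈ T} ∩ clusterInEvent ends x 𝓤) *
        prob p (clusterInEvent ends x 𝓥) +
      prob p (clusterInEvent ends x 𝓤) *
        prob p (clusterInEvent ends x {T : Set V | hv ∈ T} ∩ clusterInEvent ends x 𝓥) ≤
      prob p (clusterInEvent ends x {T : Set V | hv ∈ T} ∩ clusterInEvent ends x 𝓤 ∩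
          clusterInEvent ends x 𝓥) +
        prob p (clusterInEvent ends x {T : Set V | hv ∈ T}) *
          prob p (clusterInEvent ends x 𝓤 ∩ clusterInEvent ends x 𝓥) := by
  have hQ := hit_root_eq (EA := EA) h hvB
  have hU := clusterInEvent_root_eq (EB := EB) h h𝓤
  have hE := clusterInEvent_root_eq (EB := EB) h h𝓥
  rw [hQ, hU, hE]
  set B := sideEvent EB (clusterInEvent ends x {T : Set V | hv ∈ T}) with hB
  have r1 : B ∩ sideEvent EA (clusterInEvent ends x 𝓤) ∩ sideEvent EA (clusterInEvent ends x 𝓥) =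
      sideEvent EA (clusterInEvent ends x 𝓤 ∩ clusterInEvent ends x 𝓥) ∩ B := by
    rw [sideEvent_inter']; ext ω; simp only [Set.mem_inter_iff]; tauto
  have r2 : sideEvent EA (clusterInEvent ends x 𝓤) ∩ sideEvent EA (clusterInEvent ends x 𝓥) =
      sideEvent EA (clusterInEvent ends x 𝓤 ∩ clusterInEvent ends x 𝓥) := by
    rw [sideEvent_inter']
  have r3 : B ∩ sideEvent EA (clusterInEvent ends x 𝓤) =
      sideEvent EA (clusterInEvent ends x 𝓤) ∩ B := Set.inter_comm _ _
  have r4 : B ∩ sideEvent EA (clusterInEvent ends x 𝓥) =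
      sideEvent EA (clusterInEvent ends x 𝓥) ∩ B := Set.inter_comm _ _
  rw [r1, r2, r3, r4, hB]
  simp only [prob_sideEvent_inter_eq_mul p h, ← CDCutVertex.prob_zeroOff_eq_prob_sideEvent p EA,
    ← CDCutVertex.prob_zeroOff_eq_prob_sideEvent p EB]
  have hpA : IsProbVec (fun e => if e ∈ EA then p e else 0) := CDCutVertex.isProbVec_zeroOff hp EA
  have hpB : IsProbVec (fun e => if e ∈ EB then p e else 0) := CDCutVertex.isProbVec_zeroOff hp EB
  have hq : 0 ≤ prob (fun e => if e ∈ EB then p e else 0)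
      (clusterInEvent ends x {T : Set V | hv ∈ T}) := prob_nonneg hpB _
  have hH : prob (fun e => if e ∈ EA then p e else 0) (clusterInEvent ends x 𝓤) *
      prob (fun e => if e ∈ EA then p e else 0) (clusterInEvent ends x 𝓥) ≤
      prob (fun e => if e ∈ EA then p e else 0)
        (clusterInEvent ends x 𝓤 ∩ clusterInEvent ends x 𝓥) :=
    prob_mul_prob_le_prob_inter hpA (isUpperSet_clusterInEvent ends x h𝓤up)
      (isUpperSet_clusterInEvent ends x h𝓥up)
  nlinarith [mul_nonneg hq (sub_nonneg.2 hH)]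

end RootCut

/-! ## The hit vertex at the cut, `𝓤` beyond and `𝓥` on the root side (appended, mine-a g46):
`T = P_B(C_x ∈ 𝓤) · Cov_A({s ↔ x}, {C_s ∈ 𝓥}) ≥ 0` (`t_of_hit_cut_mixed`). -/
section HitMixed

omit [Fintype E] [DecidableEq E] [Field R] [LinearOrder R] [IsStrictOrderedRing R]
  [DecidablePred (· ∈ EB)] in
/-- A cluster event read on the root side is an `A`-side event. -/
lemma clusterInEvent_eq_side'' (h : IsCut ends x VA VB EA EB) {s : V} (hs : s ∈ VA)
    {𝓥 : Set (Set V)} (h𝓥 : ∀ S, S ∈ 𝓥 ↔ S ∩ (VA ∪ {x}) ∈ 𝓥) :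
    clusterInEvent ends s 𝓥 = sideEvent EA (clusterInEvent ends s 𝓥) := by
  ext ω
  simp only [mem_clusterInEvent, mem_sideEvent]
  rw [h𝓥 (cluster ends ω s), cluster_inter_eq h (Or.inl hs)]

omit [LinearOrder R] [IsStrictOrderedRing R] in
/-- `P({A-side event} ∩ {B-side event}) = P_{p_A}(·) · P_{p_B}(·)`. -/
lemma prob_side_inter_side'' (p : E → R) (h : IsCut ends x VA VB EA EB) (X Y : Set (Config E)) :
    prob p (sideEvent EA X ∩ sideEvent EB Y) =
      prob (fun e => if e ∈ EA then p e else 0) X * prob (fun e => if e ∈ EB then p e else 0) Y := by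
  rw [prob_sideEvent_inter_eq_mul p h, CDCutVertex.prob_zeroOff_eq_prob_sideEvent p EA X,
    CDCutVertex.prob_zeroOff_eq_prob_sideEvent p EB Y]

/-- **(T_h) is a theorem when the hit vertex is the cut vertex, `𝓤` is read beyond it and `𝓥` on
the root side**: `T = P_{p_B}(C_x ∈ 𝓤) · Cov_{p_A}({s ↔ x}, {C_s ∈ 𝓥}) ≥ 0`. -/
theorem t_of_hit_cut_mixed (p : E → R) (hp : IsProbVec p) (h : IsCut ends x VA VB EA EB) {s : V}
    (hs : s ∈ VA) {𝓤 𝓥 : Set (Set V)} (h𝓤 : ∀ S, S ∈ 𝓤 ↔ S ∩ VB ∈ 𝓤) (h𝓤0 : ∅ ∉ 𝓤)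
    (h𝓥 : ∀ S, S ∈ 𝓥 ↔ S ∩ (VA ∪ {x}) ∈ 𝓥) (h𝓥up : IsUpperSet 𝓥) :
    prob p (clusterInEvent ends s {T : Set V | x ∈ T} ∩ clusterInEvent ends s 𝓤) *
        prob p (clusterInEvent ends s 𝓥) +
      prob p (clusterInEvent ends s 𝓤) *
        prob p (clusterInEvent ends s {T : Set V | x ∈ T} ∩ clusterInEvent ends s 𝓥) ≤
      prob p (clusterInEvent ends s {T : Set V | x ∈ T} ∩ clusterInEvent ends s 𝓤 ∩
          clusterInEvent ends s 𝓥) +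
        prob p (clusterInEvent ends s {T : Set V | x ∈ T}) *
          prob p (clusterInEvent ends s 𝓤 ∩ clusterInEvent ends s 𝓥) := by
  have hQ := hit_cut_eq (EB := EB) h hs
  have hU := clusterInEvent_far_eq (EA := EA) h hs h𝓤 h𝓤0
  have mE : ∀ ω, ω ∈ clusterInEvent ends s 𝓥 ↔ restrict EA ω ∈ clusterInEvent ends s 𝓥 := fun ω => by
    simp only [mem_clusterInEvent]
    rw [h𝓥 (cluster ends ω s), cluster_inter_eq h (Or.inl hs)]
  have mQ : ∀ ω, ω ∈ clusterInEvent ends s {T : Set V | x ∈ T} ↔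
      restrict EA ω ∈ connEvent ends s x := fun ω => by rw [hQ]; exact Iff.rfl
  have mU : ∀ ω, ω ∈ clusterInEvent ends s 𝓤 ↔
      (restrict EA ω ∈ connEvent ends s x ∧ restrict EB ω ∈ clusterInEvent ends x 𝓤) := fun ω => by
    rw [hU]; exact Iff.rfl
  have s1 : clusterInEvent ends s {T : Set V | x ∈ T} ∩ clusterInEvent ends s 𝓤 ∩
      clusterInEvent ends s 𝓥 =
      sideEvent EA (connEvent ends s x ∩ clusterInEvent ends s 𝓥) ∩
        sideEvent EB (clusterInEvent ends x 𝓤) := by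
    ext ω; simp only [Set.mem_inter_iff, mem_sideEvent]; rw [mQ ω, mU ω, mE ω]; tauto
  have s2 : clusterInEvent ends s {T : Set V | x ∈ T} =
      sideEvent EA (connEvent ends s x) ∩ sideEvent EB Set.univ := by
    ext ω; simp only [Set.mem_inter_iff, mem_sideEvent, Set.mem_univ, and_true]; exact mQ ω
  have s3 : clusterInEvent ends s 𝓤 ∩ clusterInEvent ends s 𝓥 =
      sideEvent EA (connEvent ends s x ∩ clusterInEvent ends s 𝓥) ∩
        sideEvent EB (clusterInEvent ends x 𝓤) := by
    ext ω; simp only [Set.mem_inter_iff, mem_sideEvent]; rw [mU ω, mE ω]; tauto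
  have s4 : clusterInEvent ends s {T : Set V | x ∈ T} ∩ clusterInEvent ends s 𝓤 =
      sideEvent EA (connEvent ends s x) ∩ sideEvent EB (clusterInEvent ends x 𝓤) := by
    ext ω; simp only [Set.mem_inter_iff, mem_sideEvent]; rw [mQ ω, mU ω]; tauto
  have s5 : clusterInEvent ends s 𝓥 = sideEvent EA (clusterInEvent ends s 𝓥) ∩ sideEvent EB Set.univ := by
    ext ω; simp only [Set.mem_inter_iff, mem_sideEvent, Set.mem_univ, and_true]; exact mE ω
  have s6 : clusterInEvent ends s {T : Set V | x ∈ T} ∩ clusterInEvent ends s 𝓥 =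
      sideEvent EA (connEvent ends s x ∩ clusterInEvent ends s 𝓥) ∩ sideEvent EB Set.univ := by
    ext ω; simp only [Set.mem_inter_iff, mem_sideEvent, Set.mem_univ, and_true]; rw [mQ ω, mE ω]
  have s7 : clusterInEvent ends s 𝓤 =
      sideEvent EA (connEvent ends s x) ∩ sideEvent EB (clusterInEvent ends x 𝓤) := hU
  have p1 := congrArg (prob p) s1
  have p2 := congrArg (prob p) s2
  have p3 := congrArg (prob p) s3
  have p4 := congrArg (prob p) s4
  have p5 := congrArg (prob p) s5
  have p6 := congrArg (prob p) s6
  have p7 := congrArg (prob p) s7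
  rw [prob_side_inter_side'' p h] at p1 p2 p3 p4 p5 p6 p7
  rw [prob_univ] at p2 p5 p6
  rw [p1, p4, p6, p2, p3, p5, p7]
  have hpA : IsProbVec (fun e => if e ∈ EA then p e else 0) := CDCutVertex.isProbVec_zeroOff hp EA
  have hpB : IsProbVec (fun e => if e ∈ EB then p e else 0) := CDCutVertex.isProbVec_zeroOff hp EB
  have hu : 0 ≤ prob (fun e => if e ∈ EB then p e else 0) (clusterInEvent ends x 𝓤) := prob_nonneg hpB _
  have hH : prob (fun e => if e ∈ EA then p e else 0) (connEvent ends s x) *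
      prob (fun e => if e ∈ EA then p e else 0) (clusterInEvent ends s 𝓥) ≤
      prob (fun e => if e ∈ EA then p e else 0) (connEvent ends s x ∩ clusterInEvent ends s 𝓥) :=
    prob_mul_prob_le_prob_inter hpA (isUpperSet_connEvent ends s x)
      (isUpperSet_clusterInEvent ends s h𝓥up)
  nlinarith [mul_nonneg hu (sub_nonneg.2 hH)]

end HitMixed

end TCutVertexHit

end Summit.Ventures.PercRepro2
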